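import Summits.HodgeConjecture.CorCM.DihedralReflexTripleDuality
import Summits.HodgeConjecture.CorCM.DihedralReflexTripleBalancedSet
import Summits.HodgeConjecture.CorCM.CMFamilyRankClosureBound
import Literature.AlgebraicGeometry.Pohlmann1968.SeparatingCMFamilies
import HarnessLib

/-!
# The dihedral surface triple `S₁ × S₂ × S₁′` carries an exceptional Hodge class of type `(2,2)` — on the triple
# ITSELF, for every non-Galois quartic CM field, every reflex-class partner, all CM types and all realisations

COR-CM (cell `pub-hodgecm2`, seat p2 gen 19, count-neutral claim DIHEDRAL-TRIPLE, file 3 of 3); NEW as stated,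
hence under `Summits/`.  Theorems only; no definition, no named fact, no `sorry`.  Sequel of `DihedralReflexSwapReflect` /
`DihedralReflexPairCMHodge` (the mixed dihedral PAIR is nondegenerate) and of `CMFamilyRankClosureBound` (three quartic
CM fields inside one octic closure form a DEGENERATE family, so SOME product of powers `S₁^a × S₂^b × S₁′^c` carries an
exceptional Hodge class, by Hazama–Murty).  Here the exceptional class is located: it lives in `H⁴` of the triple
`S₁ × S₂ × S₁′` itself — the CM-type / realisation form of the kernel census `Census/DihedralSurfaceTriple`
(`B²(S₁ × S₂ × S₁′) = 19 = 15 + 4`, seat lit-andre-3), which is a `decide` computation in ONE toy model and is not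
imported here.

THE SITUATION.  `K` is a quartic CM field which is NOT Galois over `ℚ` (Galois closure `L ⊂ ℂ` dihedral of order `8`),
`M` a quartic CM field with `Hom(M, ℂ)` landing in `L`, `Hom(M, K) = ∅` and `M/ℚ` not Galois (the reflex class: up to
conjugacy `L` contains exactly the two non-Galois quartic CM fields `K`, `M`).  The family has THREE slots:
`(K, Φ₀)`, `(M, Ψ)`, `(K', Φ₂)` with `e : K' ≃ K` and `Φ₂ ∘ e⁻¹ ∉ {Φ₀, Φ̄₀}` — on abelian varieties: `S₁`, `S₁′` the two
isogeny classes of simple CM abelian surfaces with CM by `K` (Moonen–Zarhin: "in case (2) there are two such isogeny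
classes") and `S₂` a simple CM abelian surface with CM by `M`; the hypothesis is stated as Kubota separation of the
family (`CMAlgebra.IsSeparatingFamily`: the three surfaces are simple and pairwise non-isogenous).

THE MATHEMATICS (new; the dihedral group is never named in the proofs, everything goes through the action of `Aut(ℂ)`
on the embeddings, as in the prequels).
* §1 VERTEX–EDGE DUALITY.  A CM type `Ψ = {u, v}` of `M` is an "edge" of the square `Hom(M, ℂ) = {u, v, ū, v̄}`.  The
  swap `σ` (`σu = v`, `σv = u`; `σ = τσ₀` with Shimura's `4`-cycle and reflection of `M`, `exists_swap`) FIXES an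
  antipodal pair `{q, q̄} ⊂ Hom(K, ℂ)` (`exists_smul_eq_self_of_swap`: otherwise `σ` would be the `4`-cycle of `K`, whose
  square is complex conjugation, or the swap–reflection of `DihedralReflexSwapReflect`, which fixes an embedding of `M`),
  and the stabilisers agree: `γ q = q ⟺ γ{u, v} = {u, v}` for every `γ ∈ Aut(ℂ)` (`smul_eq_self_iff_of_swap`).  In `D₄`:
  the vertices of one square are the edges of the other.
* §2 THE EXCEPTIONAL SET.  `P = {(0, p), (1, u), (1, v), (2, p′ ∘ e)}` with `p ∈ {q, q̄} ∖ Φ₀` and `p′ ∈ {q, q̄}` with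
  `p′ ∘ e ∉ Φ₂`.  For `γ ∈ Aut(ℂ)`: if `γq = q` the four memberships `[γx ∈ type]` are `(0, 1, 1, 0)`; if `γq = q̄` they
  are `(1, 0, 0, 1)`; otherwise `γΨ ∉ {Ψ, Ψ̄}` meets `Ψ` in exactly one point, and `γp, γp′` lie over the other antipodal
  pair `{o, ō}` of `Hom(K, ℂ)`, on which `Φ₀` and `Φ₂ ∘ e⁻¹` DIFFER when `p′ = p` (they agree on `{q, q̄}` and are not
  equal) and AGREE when `p′ = p̄` (they differ on `{q, q̄}` and are not conjugate) — two memberships out of four in every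
  case: `P` is Galois-balanced (`mem_pohlmannSetsAlg_two`).  It is not a disjoint union of two balanced pairs: the pair
  through `(0, p)` would have partner `(2, p′∘e)` (count `0` at `γ = 1`), or `(1, u)` (counts at the reflection `s_u` of
  `M` fixing `u` and at `s_u σ` force `0`), or `(1, v)` (symmetrically) (`not_mem_pohlmannDivisorSetsAlg_two`).
* §3 CONSEQUENCES for every family of realisations `A : Fin 3 → AbelianVariety ℂ` of the three types: a rational
  `(2,2)`-class on `⨁ A = S₁ × S₂ × S₁′` outside `D² ⊗ ℂ` (`exists_exceptional_two_biproduct`, Pohlmann's criterion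
  `exists_exceptional_biproduct_iff` BY NAME), `B²(⨁ A) ⊗ ℂ ≠ D²(⨁ A) ⊗ ℂ`, the family is degenerate; every PAIR of the
  three surfaces is a nondegenerate family (`DihedralReflexPairCMHodge`, `QuarticCMTypePairNondegenerate`,
  `TwoSimpleCMSurfacesHodge` — not restated).  The toy-model census (all eight type choices give `19 = 15 + 4` with the
  exceptional sets predicted by §2) is the session script `work/census_triple.py` of the seat folder.

## References
* [Shimura1998] G. Shimura, *Abelian Varieties with Complex Multiplication and Modular Functions*, §8.4 Example (2)(C).
* [MoonenZarhin1999LowDim] B. Moonen, Yu. Zarhin, *Hodge classes on abelian varieties of low dimension*, Math. Ann. 315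
  (1999) 711–733, "Hodge groups of simple abelian surfaces of CM-type".
* [Pohlmann1968] H. Pohlmann, *Algebraic cycles on abelian varieties of complex multiplication type*, Ann. of Math. 88
  (1968) 161–180, Thm. 1.
* [Gordon1999HodgeAVSurvey] B. B. Gordon, *A survey of the Hodge conjecture for abelian varieties*, 7.5, 9.2.2.
-/

noncomputable section

open CategoryTheory CategoryTheory.Limits NumberField NumberField.ComplexEmbedding IntermediateField
open scoped BigOperators

namespace Summit.HodgeConjecture.CorCM

open Literature.NumberTheory.ComplexMultiplication
open Literature.NumberTheory.ComplexMultiplication.CMTypeOps (mem_iff_conjugate_notMem conjugate_mem_iff_notMem)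
open Literature.AlgebraicGeometry.Motives (AbelianVariety CMType)
open Literature.AlgebraicGeometry.HodgeTheory
open Literature.AlgebraicGeometry.ComplexMultiplication (IsCMTypeRealisation)
open Literature.AlgebraicGeometry.VanGeemen1994 (hodgeClassSpan)
open Literature.AlgebraicGeometry.Pohlmann1968
open Literature.Barriers.HodgeConjecture (divisorClassesSpan)
open QuarticCM DihedralReflexPair QuarticCMPairs

namespace DihedralReflexTriple

section Triple

variable {K : Fin 3 → Type} [∀ j, Field (K j)] [∀ j, NumberField (K j)] [∀ j, IsCMField (K j)]

/-! ### §3 The triple: an exceptional Pohlmann `4`-set in degree `2` -/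

/-- **Main index-set theorem.**  For the three-slot family `(K₀, Φ₀)`, `(K₁, Ψ)`, `(K₂, Φ₂)` with `K₀` a non-Galois
quartic CM field, `K₁` a non-Galois quartic CM field whose complex embeddings land in the Galois closure of `K₀` and
which does not embed into `K₀`, `K₂ ≃ K₀`, and a SEPARATING family of types (e.g. `Φ₂ ∘ e⁻¹ ∉ {Φ₀, Φ̄₀}`): some
Galois-balanced `4`-subset of `Hom(K₀, ℂ) ⊔ Hom(K₁, ℂ) ⊔ Hom(K₂, ℂ)` is not a disjoint union of two balanced pairs —
namely `{(0,p), (1,u), (1,v), (2,p′∘e)}` of §2, with `{q, q̄}` the pair fixed by the swap of `Ψ = {u, v}` (§1),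
`p ∈ {q, q̄} ∖ Φ₀`, and `p′ = p` or `p̄` according as `Φ₀` and `Φ₂ ∘ e⁻¹` agree or differ on `{q, q̄}` (they are
neither equal nor conjugate, `QuarticCMPairs.not_mem_and_mem_of_isSeparatingFamily`).
[cite: Pohlmann1968, Thm. 1] [cite: Gordon1999HodgeAVSurvey, 9.2.2] [cite: MoonenZarhin1999LowDim, "Hodge groups of
simple abelian surfaces of CM-type"] -/
theorem pohlmannSetsAlg_two_diff_nonempty (h4₀ : Module.finrank ℚ (K 0) = 4) (hK₀ : ¬IsGalois ℚ (K 0))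
    (h4₁ : Module.finrank ℚ (K 1) = 4) (hK₁ : ¬IsGalois ℚ (K 1))
    (hMK : ∀ (t : K 1 →+* ℂ) (y : K 1), t y ∈ normalClosure ℚ (K 0) ℂ) (hne : IsEmpty (K 1 →+* K 0))
    (e : K 2 ≃+* K 0) {Φ : ∀ j, CMType (K j)} (hsep : CMAlgebra.IsSeparatingFamily Φ) :
    (pohlmannSetsAlg Φ 2 \ pohlmannDivisorSetsAlg Φ 2).Nonempty := by
  classical
  -- §1: `Ψ = {u, v}`, the swap `σ`, its fixed pair `{q, q̄}`, the other pair `{o, ō}`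
  obtain ⟨u, v, hvu, hvu', hΨ⟩ := exists_mem_mem_ne h4₁ (Φ 1)
  obtain ⟨σ, hσu, hσv⟩ := exists_swap h4₁ hK₁ hvu hvu'
  obtain ⟨q, hq⟩ := exists_smul_eq_self_of_swap h4₀ hK₀ h4₁ hMK hne hvu hvu' hσu hσv
  have hKM := apply_mem_normalClosure_partner h4₀ hK₀ h4₁ hK₁ hMK
  have hstab : ∀ γ : ℂ ≃+* ℂ, γ • q = q ↔ (γ • u = u ∧ γ • v = v) ∨ (γ • u = v ∧ γ • v = u) :=
    smul_eq_self_iff_of_swap h4₀ h4₁ hMK hKM hvu hvu' hσu hσv hq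
  obtain ⟨o, hoq, hoq'⟩ := exists_ne_ne_conjugate h4₀ q
  -- `Φ₀ = {a, b}`; `Φ₂ ∘ e⁻¹` is neither `Φ₀` nor `Φ̄₀`
  obtain ⟨a, b, hba, hba', hΦ0⟩ := exists_mem_mem_ne h4₀ (Φ 0)
  obtain ⟨hn1, hn2⟩ := not_mem_and_mem_of_isSeparatingFamily (i₀ := (0 : Fin 3)) (i₁ := (2 : Fin 3))
    (by simp) h4₀ e hsep hba hba' hΦ0
  have hR : ∀ s : K 0 →+* ℂ, (conjugate s).comp e.toRingHom ∈ (Φ 2).1 ↔ s.comp e.toRingHom ∉ (Φ 2).1 :=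
    fun s => by rw [← conjugate_comp_ringEquiv]; exact conjugate_mem_iff_notMem _ _
  -- agreement of `Φ₀` and `Φ₂ ∘ e⁻¹` at `s` is a property of the pair `{s, s̄}`
  have hAc : ∀ s : K 0 →+* ℂ, (s ∈ (Φ 0).1 ↔ s.comp e.toRingHom ∈ (Φ 2).1) →
      (conjugate s ∈ (Φ 0).1 ↔ (conjugate s).comp e.toRingHom ∈ (Φ 2).1) := fun s h => by
    rw [hR s, conjugate_mem_iff_notMem]
    exact not_congr h
  have hAc' : ∀ s : K 0 →+* ℂ, (conjugate s ∈ (Φ 0).1 ↔ (conjugate s).comp e.toRingHom ∈ (Φ 2).1) →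
      (s ∈ (Φ 0).1 ↔ s.comp e.toRingHom ∈ (Φ 2).1) := fun s h => by
    have h' := hAc (conjugate s) h
    rwa [involutive_conjugate] at h'
  have ha0 : a ∈ (Φ 0).1 := (hΦ0 a).2 (Or.inl rfl)
  have hb0 : b ∈ (Φ 0).1 := (hΦ0 b).2 (Or.inr rfl)
  have hdiff : ∃ s, ¬(s ∈ (Φ 0).1 ↔ s.comp e.toRingHom ∈ (Φ 2).1) := by
    by_cases h : a.comp e.toRingHom ∈ (Φ 2).1
    · exact ⟨b, fun hb => hn1 ⟨h, hb.1 hb0⟩⟩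
    · exact ⟨a, fun ha => h (ha.1 ha0)⟩
  have hagree : ∃ s, (s ∈ (Φ 0).1 ↔ s.comp e.toRingHom ∈ (Φ 2).1) := by
    by_cases h : (conjugate a).comp e.toRingHom ∈ (Φ 2).1
    · refine ⟨b, iff_of_true hb0 ?_⟩
      by_contra hb
      exact hn2 ⟨h, (hR b).2 hb⟩
    · exact ⟨a, iff_of_true ha0 (not_not.1 fun ha => h ((hR a).2 ha))⟩
  -- `p ∈ {q, q̄} ∖ Φ₀`
  obtain ⟨p, hp, hpΦ⟩ : ∃ p, (p = q ∨ p = conjugate q) ∧ p ∉ (Φ 0).1 := by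
    by_cases h : q ∈ (Φ 0).1
    · exact ⟨conjugate q, Or.inr rfl, (mem_iff_conjugate_notMem _ q).1 h⟩
    · exact ⟨q, Or.inl rfl, h⟩
  have hσp : σ • p = p := by
    rcases hp with rfl | rfl
    · exact hq
    · rw [smul_conjugate, hq]
  by_cases hAq : (q ∈ (Φ 0).1 ↔ q.comp e.toRingHom ∈ (Φ 2).1)
  · -- `Φ₀` and `Φ₂ ∘ e⁻¹` agree on `{q, q̄}`: `p′ = p`, and they differ on `{o, ō}`
    have hAp : (p ∈ (Φ 0).1 ↔ p.comp e.toRingHom ∈ (Φ 2).1) := by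
      rcases hp with rfl | rfl
      · exact hAq
      · exact hAc q hAq
    have hp'Φ : p.comp e.toRingHom ∉ (Φ 2).1 := fun h => hpΦ (hAp.2 h)
    have hKo : ∀ w, w = o ∨ w = conjugate o → (w ∈ (Φ 0).1 ↔ w.comp e.toRingHom ∉ (Φ 2).1) := by
      obtain ⟨s, hs⟩ := hdiff
      have hso : ¬(o ∈ (Φ 0).1 ↔ o.comp e.toRingHom ∈ (Φ 2).1) := by
        rcases eq_or_eq_or_eq_or_eq h4₀ hoq hoq' s with rfl | rfl | rfl | rfl
        · exact absurd hAq hs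
        · exact absurd (hAc q hAq) hs
        · exact hs
        · exact fun ho => hs (hAc o ho)
      have hsō : ¬(conjugate o ∈ (Φ 0).1 ↔ (conjugate o).comp e.toRingHom ∈ (Φ 2).1) :=
        fun h => hso (hAc' o h)
      intro w hw
      rcases hw with rfl | rfl
      · exact ⟨fun ha hb => hso (iff_of_true ha hb), fun hb => by_contra fun ha => hso (iff_of_false ha hb)⟩
      · exact ⟨fun ha hb => hsō (iff_of_true ha hb), fun hb => by_contra fun ha => hsō (iff_of_false ha hb)⟩
    exact ⟨_, mem_pohlmannSetsAlg_two h4₀ Φ e hvu hΨ hoq hoq' hstab hp hpΦ hp'Φ (Or.inl ⟨rfl, hKo⟩),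
      not_mem_pohlmannDivisorSetsAlg_two h4₁ hK₁ Φ e hvu hvu' hΨ hσu hσv hσp hpΦ hp'Φ⟩
  · -- they differ on `{q, q̄}`: `p′ = p̄`, and they agree on `{o, ō}`
    have hAp : ¬(p ∈ (Φ 0).1 ↔ p.comp e.toRingHom ∈ (Φ 2).1) := by
      rcases hp with rfl | rfl
      · exact hAq
      · exact fun h => hAq (hAc' q h)
    have hp'Φ : (conjugate p).comp e.toRingHom ∉ (Φ 2).1 := by
      rw [hR, not_not]
      by_contra h
      exact hAp (iff_of_false hpΦ h)
    have hKo : ∀ w, w = o ∨ w = conjugate o → (w ∈ (Φ 0).1 ↔ w.comp e.toRingHom ∈ (Φ 2).1) := by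
      obtain ⟨s, hs⟩ := hagree
      have hso : (o ∈ (Φ 0).1 ↔ o.comp e.toRingHom ∈ (Φ 2).1) := by
        rcases eq_or_eq_or_eq_or_eq h4₀ hoq hoq' s with rfl | rfl | rfl | rfl
        · exact absurd hs hAq
        · exact absurd (hAc' q hs) hAq
        · exact hs
        · exact hAc' o hs
      intro w hw
      rcases hw with rfl | rfl
      · exact hso
      · exact hAc o hso
    exact ⟨_, mem_pohlmannSetsAlg_two h4₀ Φ e hvu hΨ hoq hoq' hstab hp hpΦ hp'Φ (Or.inr ⟨rfl, hKo⟩),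
      not_mem_pohlmannDivisorSetsAlg_two h4₁ hK₁ Φ e hvu hvu' hΨ hσu hσv hσp hpΦ hp'Φ⟩

omit [∀ j, IsCMField (K j)] in
/-- `[K₂ : ℚ] = [K₀ : ℚ]` along the ring isomorphism `e`. [folklore] -/
private theorem finrank_eq_of_ringEquiv (e : K 2 ≃+* K 0) : Module.finrank ℚ (K 2) = Module.finrank ℚ (K 0) :=
  (AlgEquiv.ofRingEquiv (f := e) fun q => by simp).toLinearEquiv.finrank_eq

/-- **The triple is a DEGENERATE family** (rank `≤ [L:ℚ]/2 + 1 = 5 < 7`; `CMFamilyRankClosureBound`, by name) — every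
PAIR inside it being nondegenerate (`DihedralReflexPairCMHodge`, `QuarticCMTypePairNondegenerate`).
[cite: Gordon1999HodgeAVSurvey, 7.5–7.7] [cite: MoonenZarhin1999LowDim, "Hodge groups of simple abelian surfaces of
CM-type"] -/
theorem not_isNondegenerateFamily (h4₀ : Module.finrank ℚ (K 0) = 4) (hK₀ : ¬IsGalois ℚ (K 0))
    (h4₁ : Module.finrank ℚ (K 1) = 4) (hMK : ∀ (t : K 1 →+* ℂ) (y : K 1), t y ∈ normalClosure ℚ (K 0) ℂ)
    (e : K 2 ≃+* K 0) (Φ : ∀ j, CMType (K j)) : ¬CMAlgebra.IsNondegenerateFamily Φ := by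
  refine not_isNondegenerateFamily_of_quartic_of_mem_normalClosure Φ 0 h4₀ hK₀ (fun j => ?_) (fun j s y => ?_)
    (by simp)
  · fin_cases j
    · exact h4₀.ge
    · exact h4₁.ge
    · exact ((finrank_eq_of_ringEquiv e).trans h4₀).ge
  · fin_cases j
    · exact s.toRatAlgHom.fieldRange_le_normalClosure ⟨y, rfl⟩
    · exact hMK s y
    · obtain ⟨s', rfl⟩ := exists_eq_comp_ringEquiv e s
      exact s'.toRatAlgHom.fieldRange_le_normalClosure ⟨e y, rfl⟩

end Triple

/-! ### §4 On abelian varieties: an exceptional `(2,2)`-class on `S₁ × S₂ × S₁′` itself -/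

section Geometry

variable {K : Fin 3 → Type} [∀ j, Field (K j)] [∀ j, NumberField (K j)] [∀ j, IsCMField (K j)]
  {Φ : ∀ j, CMType (K j)} {A : Fin 3 → AbelianVariety ℂ} {ι : ∀ j, 𝓞 (K j) →+* End (A j)}
  {θ : ∀ j, K j →+* Module.End ℂ (complexBetti (A j).X 1)}

/-- **An exceptional Hodge class on the dihedral surface triple itself.**  For every family of realisations
`(A_j, ι_j, θ_j)` of a separating three-slot family `(K₀, Φ₀)`, `(K₁, Ψ)`, `(K₂ ≃ K₀, Φ₂)` as in
`pohlmannSetsAlg_two_diff_nonempty` — three pairwise non-isogenous simple CM abelian surfaces `S₁, S₂, S₁′` with `S₁, S₁′`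
the two isogeny classes of CM surfaces of a non-Galois quartic CM field `K` and `S₂` a CM surface of the reflex class —
the sixfold `⨁ A = S₁ × S₂ × S₁′` carries a rational class of Hodge type `(2,2)` OUTSIDE the `ℂ`-span `D² ⊗ ℂ` of
products of divisor classes (Pohlmann's criterion `exists_exceptional_biproduct_iff`, by name).  Its algebraicity is
decided neither by Moonen–Zarhin (dimension `6 > 5`) nor by Markman (no imaginary quadratic field acts).
[cite: Pohlmann1968, Thm. 1] [cite: Gordon1999HodgeAVSurvey, 9.2.2] [cite: MoonenZarhin1999LowDim, "Hodge groups of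
simple abelian surfaces of CM-type"] -/
theorem exists_exceptional_two_biproduct (h4₀ : Module.finrank ℚ (K 0) = 4) (hK₀ : ¬IsGalois ℚ (K 0))
    (h4₁ : Module.finrank ℚ (K 1) = 4) (hK₁ : ¬IsGalois ℚ (K 1))
    (hMK : ∀ (t : K 1 →+* ℂ) (y : K 1), t y ∈ normalClosure ℚ (K 0) ℂ) (hne : IsEmpty (K 1 →+* K 0))
    (e : K 2 ≃+* K 0) (hsep : CMAlgebra.IsSeparatingFamily Φ)
    (hA : ∀ j, IsCMTypeRealisation (Φ j) (A j) (ι j) (θ j)) :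
    ∃ c : complexBetti (⨁ A).X (2 * 2), IsRationalClass c ∧
      IsOfHodgeType (⨁ A).dim (⨁ A).X (2 * 2) 2 2 c ∧ c ∉ divisorClassesSpan (⨁ A).X (⨁ A).dim 2 :=
  (exists_exceptional_biproduct_iff hA 2).2 (pohlmannSetsAlg_two_diff_nonempty h4₀ hK₀ h4₁ hK₁ hMK hne e hsep)

/-- **`B²(S₁ × S₂ × S₁′) ⊗ ℂ ≠ D²(S₁ × S₂ × S₁′) ⊗ ℂ`**: the Hodge classes of codimension `2` on the dihedral surface
triple are not spanned by products of divisor classes. [cite: Pohlmann1968, Thm. 1] [cite: Gordon1999HodgeAVSurvey,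
9.2.2] -/
theorem hodgeClassSpan_two_ne_divisorClassesSpan (h4₀ : Module.finrank ℚ (K 0) = 4) (hK₀ : ¬IsGalois ℚ (K 0))
    (h4₁ : Module.finrank ℚ (K 1) = 4) (hK₁ : ¬IsGalois ℚ (K 1))
    (hMK : ∀ (t : K 1 →+* ℂ) (y : K 1), t y ∈ normalClosure ℚ (K 0) ℂ) (hne : IsEmpty (K 1 →+* K 0))
    (e : K 2 ≃+* K 0) (hsep : CMAlgebra.IsSeparatingFamily Φ)
    (hA : ∀ j, IsCMTypeRealisation (Φ j) (A j) (ι j) (θ j)) :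
    hodgeClassSpan (⨁ A).dim (⨁ A).X 2 ≠ divisorClassesSpan (⨁ A).X (⨁ A).dim 2 := by
  obtain ⟨c, hcQ, hcH, hcD⟩ := exists_exceptional_two_biproduct h4₀ hK₀ h4₁ hK₁ hMK hne e hsep hA
  exact fun h => hcD (h ▸ Submodule.subset_span ⟨hcQ, hcH⟩)

/-- **`dim_ℂ D²(S₁ × S₂ × S₁′) ⊗ ℂ < dim_ℂ B²(S₁ × S₂ × S₁′) ⊗ ℂ`** (White's count
`finrank_hodgeClassSpan_sub_finrank_divisorClassesSpan_biproduct`, by name; the toy-model census gives `15 < 19`).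
[cite: Gordon1999HodgeAVSurvey, 9.2.2] [cite: Pohlmann1968, Thm. 1] -/
theorem finrank_divisorClassesSpan_two_lt (h4₀ : Module.finrank ℚ (K 0) = 4) (hK₀ : ¬IsGalois ℚ (K 0))
    (h4₁ : Module.finrank ℚ (K 1) = 4) (hK₁ : ¬IsGalois ℚ (K 1))
    (hMK : ∀ (t : K 1 →+* ℂ) (y : K 1), t y ∈ normalClosure ℚ (K 0) ℂ) (hne : IsEmpty (K 1 →+* K 0))
    (e : K 2 ≃+* K 0) (hsep : CMAlgebra.IsSeparatingFamily Φ)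
    (hA : ∀ j, IsCMTypeRealisation (Φ j) (A j) (ι j) (θ j)) :
    Module.finrank ℂ ↥(divisorClassesSpan (⨁ A).X (⨁ A).dim 2) <
      Module.finrank ℂ ↥(hodgeClassSpan (⨁ A).dim (⨁ A).X 2) := by
  have h := finrank_hodgeClassSpan_sub_finrank_divisorClassesSpan_biproduct hA 2
  have hpos : 0 < (pohlmannSetsAlg Φ 2 \ pohlmannDivisorSetsAlg Φ 2).ncard :=
    (Set.ncard_pos (Set.toFinite _)).2 (pohlmannSetsAlg_two_diff_nonempty h4₀ hK₀ h4₁ hK₁ hMK hne e hsep)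
  omega

/-- **Geometric dress.**  Three SIMPLE, PAIRWISE NON-ISOGENOUS complex abelian surfaces `A₀, A₁, A₂` realising CM types
of `K₀` (a non-Galois quartic CM field), of `K₁` (a non-Galois quartic CM field with `Hom(K₁, ℂ)` in the Galois closure
of `K₀` and `Hom(K₁, K₀) = ∅`) and of `K₂ ≃ K₀`: the sixfold `A₀ × A₁ × A₂` carries a rational `(2,2)`-class outside
`D² ⊗ ℂ` (Kubota separation from simplicity and non-isogeny:
`CMAlgebra.isSeparatingFamily_of_isSimple_of_pairwise_not_isIsogenous`). [cite: Pohlmann1968, Thm. 1]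
[cite: MoonenZarhin1999LowDim, "Hodge groups of simple abelian surfaces of CM-type"] [cite: Gordon1999HodgeAVSurvey, 7.4
and 9.2.2] -/
theorem exists_exceptional_two_biproduct_of_isSimple (h4₀ : Module.finrank ℚ (K 0) = 4) (hK₀ : ¬IsGalois ℚ (K 0))
    (h4₁ : Module.finrank ℚ (K 1) = 4) (hK₁ : ¬IsGalois ℚ (K 1))
    (hMK : ∀ (t : K 1 →+* ℂ) (y : K 1), t y ∈ normalClosure ℚ (K 0) ℂ) (hne : IsEmpty (K 1 →+* K 0))
    (e : K 2 ≃+* K 0) (hA : ∀ j, IsCMTypeRealisation (Φ j) (A j) (ι j) (θ j)) (hS : ∀ j, (A j).IsSimple)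
    (hni : ∀ i j, i ≠ j → ¬AbelianVariety.IsIsogenous (A i) (A j)) :
    ∃ c : complexBetti (⨁ A).X (2 * 2), IsRationalClass c ∧
      IsOfHodgeType (⨁ A).dim (⨁ A).X (2 * 2) 2 2 c ∧ c ∉ divisorClassesSpan (⨁ A).X (⨁ A).dim 2 :=
  exists_exceptional_two_biproduct h4₀ hK₀ h4₁ hK₁ hMK hne e
    (CMAlgebra.isSeparatingFamily_of_isSimple_of_pairwise_not_isIsogenous hA hS hni) hA

end Geometry

end DihedralReflexTriple

end Summit.HodgeConjecture.CorCM

end
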